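import Mathlib
import HarnessLib

/-!
# Route `PoloidalWindowDoor`, crux `PoloidalWindowRigidity` (K2, stmt-NavierStokesRegularity-19708), skeleton `lrc-jet` v5,
# stub `stub_untwisted` — brick F4: THE STUART BRANCH IS EMPTY (Branch 2b of UNTWISTED-NOTE §3, polynomial-degree form)

Cell ns-regularity-ideate, K2 lead ns-poloidal-K2-p1 (gen 6; `--supports stmt-NavierStokesRegularity-19708`, helper toward the registered stub
`stub_untwisted`; paper proof `Cruxes/PoloidalWindowRigidity/UNTWISTED-NOTE.md` §3 (2b), refuter1 K-READ K-39 PASS; CAS kit j283986/j284033 for the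
polynomial bookkeeping).  PURE ONE- AND TWO-VARIABLE REAL ANALYSIS — no Navier–Stokes object, no `ℝ³`.

The situation («Branch 2b», in the height-rigid coordinate `u` of an untwisted poloidal germ, UNTWISTED-NOTE §3): on a rectangle of `(u, z)` one has a
function `H(u,z) ≠ 0` (it is `G_u − Q_u = G_u(1−Λ)`) with
* (β)  `∂_z H = (d(z)·Θ(u) + ε(z))·H`        — the vertical log-derivative of `H` is AFFINE in `Θ(u)` (`Θ′ = θ ≠ 0`, `d ≠ 0`);
* (α)  `∂_z² H = −(d(z)·M₁(u) + d″(z)·θ(u))`   — from `G_zz = −d(z)M(u)` (the divergence identity in Branch 2) differentiated in `u`.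
CLAIM: impossible.  PROOF (all algebra CAS-checked): with `ξ = dΘ + ε`, `S = ξ_z + ξ²`: (4) `S·H = −(dM₁ + d″θ)`; its `z`-derivative (4z)
`(S_z + Sξ)·H = −(d′M₁ + d‴θ)`; Cramer on (4),(4z): (5) `H·B = θ·r`, `B := d(S_z + Sξ) − d′S` a CUBIC polynomial in `Θ` with leading coefficient `d⁴`,
`r := d′d″ − d d‴`.  If `r ≡ 0`: `B(Θ(u)) = 0` for all `u`, infinitely many roots ⇒ `d⁴ = 0`.  If `r(z₁) ≠ 0`: at the height `z₁`, `B = θr/H`, so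
`B_z/B = r′/r − ξ` is again affine in `Θ(u)` with `u`-derivative `−dθ`; but `B_z/B` is a rational function of `Θ(u)`, and comparing gives the sextic
identity `Q(Θ) := B·∂_Θ B_z − B_z·∂_Θ B + d·B² = 0` with leading coefficient `d·(d⁴)² = d⁹` ⇒ `d = 0`.  Contradiction either way.

* `cubic_coeff3_eq_zero`, `sextic_coeff6_eq_zero` — a real polynomial of degree ≤ 3 (≤ 6) vanishing on an infinite set has zero top coefficient;
* `injOn_of_hasDerivAt_ne_zero` — Rolle: `Θ′ ≠ 0` on an interval ⇒ `Θ` injective there (so `Θ(I)` is infinite);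
* `stuartBranch_false` — **the theorem** (hypotheses: the derivative data of `d` (four derivatives), `ε` (three), `Θ` on open intervals, `H, ∂_zH, ∂_z²H`,
  (α), (β)).

WHAT THIS IS NOT: not a claim about Navier–Stokes regularity and not the stub — the real-analysis kernel of its last branch (bears_on LADDER-NS N0 via
crux K2 = stmt-19708).  The translation from the intrinsic branch conditions `D₁ ≡ 0`, `D₃ ≡ 0` (bricks F3a/F3b) to (α),(β) is the sequel.
-/

noncomputable section

-- the summit and its single sub-problem share the name (CONVENTIONS §1), as in every Theorems file
set_option linter.dupNamespace false

namespace Summit.NavierStokesRegularity.NavierStokesRegularity.Theorems.PoloidalWindowDoorPoloidalWindowRigidityUntwistedStuartBranch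

open Set Function Filter Topology Polynomial

/-! ### Polynomial bookkeeping -/

/-- A real cubic `b₀ + b₁t + b₂t² + b₃t³` vanishing on an infinite set has `b₃ = 0`. [folklore] -/
theorem cubic_coeff3_eq_zero {T : Set ℝ} (hT : T.Infinite) {b0 b1 b2 b3 : ℝ}
    (h : ∀ t ∈ T, b0 + b1 * t + b2 * t ^ 2 + b3 * t ^ 3 = 0) : b3 = 0 := by
  set p : ℝ[X] := C b0 + C b1 * X + C b2 * X ^ 2 + C b3 * X ^ 3 with hp
  have hroots : Set.Infinite {t : ℝ | p.IsRoot t} := by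
    refine hT.mono fun t ht => ?_
    simp only [Set.mem_setOf_eq, Polynomial.IsRoot.def, hp, eval_add, eval_mul, eval_C, eval_X, eval_pow]
    exact h t ht
  have hp0 : p = 0 := Polynomial.eq_zero_of_infinite_isRoot p hroots
  have h3 : p.coeff 3 = b3 := by
    simp [hp]
  rw [hp0, coeff_zero] at h3
  exact h3.symm

/-- A real polynomial `q₀ + q₁t + ⋯ + q₆t⁶` vanishing on an infinite set has `q₆ = 0`. [folklore] -/
theorem sextic_coeff6_eq_zero {T : Set ℝ} (hT : T.Infinite) {q0 q1 q2 q3 q4 q5 q6 : ℝ}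
    (h : ∀ t ∈ T, q0 + q1 * t + q2 * t ^ 2 + q3 * t ^ 3 + q4 * t ^ 4 + q5 * t ^ 5 + q6 * t ^ 6 = 0) : q6 = 0 := by
  set p : ℝ[X] := C q0 + C q1 * X + C q2 * X ^ 2 + C q3 * X ^ 3 + C q4 * X ^ 4 + C q5 * X ^ 5 + C q6 * X ^ 6 with hp
  have hroots : Set.Infinite {t : ℝ | p.IsRoot t} := by
    refine hT.mono fun t ht => ?_
    simp only [Set.mem_setOf_eq, Polynomial.IsRoot.def, hp, eval_add, eval_mul, eval_C, eval_X, eval_pow]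
    exact h t ht
  have hp0 : p = 0 := Polynomial.eq_zero_of_infinite_isRoot p hroots
  have h6 : p.coeff 6 = q6 := by
    simp [hp]
  rw [hp0, coeff_zero] at h6
  exact h6.symm

/-- **Rolle**: a function with non-vanishing derivative on an open interval is injective there. [folklore] -/
theorem injOn_of_hasDerivAt_ne_zero {a b : ℝ} {Θ θ : ℝ → ℝ} (hΘ : ∀ u ∈ Ioo a b, HasDerivAt Θ (θ u) u)
    (hθ : ∀ u ∈ Ioo a b, θ u ≠ 0) : InjOn Θ (Ioo a b) := by
  intro u₁ hu₁ u₂ hu₂ heq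
  by_contra hne
  rcases lt_or_gt_of_ne hne with hlt | hlt
  · have hsub : Icc u₁ u₂ ⊆ Ioo a b := fun x hx => ⟨hu₁.1.trans_le hx.1, hx.2.trans_lt hu₂.2⟩
    have hcont : ContinuousOn Θ (Icc u₁ u₂) := fun x hx => (hΘ x (hsub hx)).continuousAt.continuousWithinAt
    obtain ⟨c, hc, hc0⟩ := exists_hasDerivAt_eq_zero hlt hcont heq (fun x hx => hΘ x (hsub (Ioo_subset_Icc_self hx)))
    exact hθ c (hsub (Ioo_subset_Icc_self hc)) hc0
  · have hsub : Icc u₂ u₁ ⊆ Ioo a b := fun x hx => ⟨hu₂.1.trans_le hx.1, hx.2.trans_lt hu₁.2⟩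
    have hcont : ContinuousOn Θ (Icc u₂ u₁) := fun x hx => (hΘ x (hsub hx)).continuousAt.continuousWithinAt
    obtain ⟨c, hc, hc0⟩ := exists_hasDerivAt_eq_zero hlt hcont heq.symm (fun x hx => hΘ x (hsub (Ioo_subset_Icc_self hx)))
    exact hθ c (hsub (Ioo_subset_Icc_self hc)) hc0

/-! ### The Stuart branch is empty -/

/-- **BRANCH 2b OF THE SEPARATION IS EMPTY (UNTWISTED-NOTE §3 (2b)).**  Let `a₁ < b₁`, `a₂ < b₂`.  On `Ioo a₁ b₁` let `Θ` have derivative `θ ≠ 0`;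
on `Ioo a₂ b₂` let `d ≠ 0` have four successive derivatives `d₁, d₂, d₃, d₄` and `ε` three (`ε₁, ε₂, ε₃`).  Suppose `H : ℝ → ℝ → ℝ` is nowhere zero on the
rectangle, with `z`-derivatives `Hz` and `Hzz`, and
(β) `Hz u z = (d z · Θ u + ε z) · H u z`,  (α) `Hzz u z = −(d z · M₁ u + d₂ z · θ u)`  for some function `M₁`.  Then `False`.
(Proof: (4) `S H = −(dM₁ + d₂θ)`, (4z) `(S_z + Sξ)H = −(d₁M₁ + d₃θ)`, (5) `H B = θ r` with `B` cubic in `Θ` of top coefficient `d⁴`, `r = d₁d₂ − d d₃`; `r ≡ 0`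
gives infinitely many roots of the cubic; `r(z₁) ≠ 0` gives the sextic `Q = B ∂_ΘB_z − B_z ∂_ΘB + d B² ≡ 0` in `Θ(u)` of top coefficient `d⁹`.) [folklore] -/
theorem stuartBranch_false {a₁ b₁ a₂ b₂ : ℝ} (hI : a₁ < b₁) (hJ : a₂ < b₂)
    {Θ θ M₁ d d₁ d₂ d₃ d₄ ε ε₁ ε₂ ε₃ : ℝ → ℝ} {H Hz Hzz : ℝ → ℝ → ℝ}
    (hΘ : ∀ u ∈ Ioo a₁ b₁, HasDerivAt Θ (θ u) u) (hθ : ∀ u ∈ Ioo a₁ b₁, θ u ≠ 0)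
    (hd : ∀ z ∈ Ioo a₂ b₂, HasDerivAt d (d₁ z) z) (hd₁ : ∀ z ∈ Ioo a₂ b₂, HasDerivAt d₁ (d₂ z) z)
    (hd₂ : ∀ z ∈ Ioo a₂ b₂, HasDerivAt d₂ (d₃ z) z) (hd₃ : ∀ z ∈ Ioo a₂ b₂, HasDerivAt d₃ (d₄ z) z)
    (hd0 : ∀ z ∈ Ioo a₂ b₂, d z ≠ 0)
    (hε : ∀ z ∈ Ioo a₂ b₂, HasDerivAt ε (ε₁ z) z) (hε₁ : ∀ z ∈ Ioo a₂ b₂, HasDerivAt ε₁ (ε₂ z) z)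
    (hε₂ : ∀ z ∈ Ioo a₂ b₂, HasDerivAt ε₂ (ε₃ z) z)
    (hH0 : ∀ u ∈ Ioo a₁ b₁, ∀ z ∈ Ioo a₂ b₂, H u z ≠ 0)
    (hHz : ∀ u ∈ Ioo a₁ b₁, ∀ z ∈ Ioo a₂ b₂, HasDerivAt (H u) (Hz u z) z)
    (hHzz : ∀ u ∈ Ioo a₁ b₁, ∀ z ∈ Ioo a₂ b₂, HasDerivAt (Hz u) (Hzz u z) z)
    (hβ : ∀ u ∈ Ioo a₁ b₁, ∀ z ∈ Ioo a₂ b₂, Hz u z = (d z * Θ u + ε z) * H u z)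
    (hα : ∀ u ∈ Ioo a₁ b₁, ∀ z ∈ Ioo a₂ b₂, Hzz u z = -(d z * M₁ u + d₂ z * θ u)) : False := by
  -- notation for the explicit polynomial pieces (as functions of `(u,z)` through `Θ u` and the jets of `d, ε` at `z`)
  set ξ : ℝ → ℝ → ℝ := fun u z => d z * Θ u + ε z with hξ
  set ξz : ℝ → ℝ → ℝ := fun u z => d₁ z * Θ u + ε₁ z with hξz
  set S : ℝ → ℝ → ℝ := fun u z => ξz u z + ξ u z ^ 2 with hS
  set Sz : ℝ → ℝ → ℝ := fun u z => (d₂ z * Θ u + ε₂ z) + 2 * (ξ u z * ξz u z) with hSz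
  set B : ℝ → ℝ → ℝ := fun u z => d z * (Sz u z + S u z * ξ u z) - d₁ z * S u z with hB
  set r : ℝ → ℝ := fun z => d₁ z * d₂ z - d z * d₃ z with hr
  have hIo : IsOpen (Ioo a₁ b₁) := isOpen_Ioo
  have hJo : IsOpen (Ioo a₂ b₂) := isOpen_Ioo
  -- (4): `S·H = −(d M₁ + d₂ θ)`
  have h4 : ∀ u ∈ Ioo a₁ b₁, ∀ z ∈ Ioo a₂ b₂, S u z * H u z = -(d z * M₁ u + d₂ z * θ u) := by
    intro u hu z hz
    -- differentiate (β) in `z` and compare with (α)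
    have hprod : HasDerivAt (fun z' => (d z' * Θ u + ε z') * H u z')
        ((d₁ z * Θ u + ε₁ z) * H u z + (d z * Θ u + ε z) * Hz u z) z :=
      (((hd z hz).mul_const (Θ u)).add (hε z hz)).mul (hHz u hu z hz)
    have hev : (fun z' => (d z' * Θ u + ε z') * H u z') =ᶠ[𝓝 z] Hz u := by
      filter_upwards [hJo.mem_nhds hz] with z' hz' using (hβ u hu z' hz').symm
    have huniq : Hzz u z = (d₁ z * Θ u + ε₁ z) * H u z + (d z * Θ u + ε z) * Hz u z :=
      (hHzz u hu z hz).unique (hprod.congr_of_eventuallyEq hev.symm)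
    rw [hα u hu z hz, hβ u hu z hz] at huniq
    simp only [hS, hξ, hξz]
    linear_combination -huniq
  -- (4z): its `z`-derivative, `(S_z + S ξ)·H = −(d₁ M₁ + d₃ θ)`
  have h4z : ∀ u ∈ Ioo a₁ b₁, ∀ z ∈ Ioo a₂ b₂, (Sz u z + S u z * ξ u z) * H u z = -(d₁ z * M₁ u + d₃ z * θ u) := by
    intro u hu z hz
    have hSd : HasDerivAt (fun z' => S u z') (Sz u z) z := by
      have h1 : HasDerivAt (fun z' => ξ u z') (ξz u z) z := ((hd z hz).mul_const (Θ u)).add (hε z hz)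
      have h2 : HasDerivAt (fun z' => ξz u z') (d₂ z * Θ u + ε₂ z) z := ((hd₁ z hz).mul_const (Θ u)).add (hε₁ z hz)
      have h3 := h2.add (h1.pow 2)
      refine h3.congr_deriv ?_
      simp only [hSz, Nat.cast_ofNat]
      ring
    have hLHS : HasDerivAt (fun z' => S u z' * H u z') (Sz u z * H u z + S u z * Hz u z) z := hSd.mul (hHz u hu z hz)
    have hRHS : HasDerivAt (fun z' => -(d z' * M₁ u + d₂ z' * θ u)) (-(d₁ z * M₁ u + d₃ z * θ u)) z :=
      (((hd z hz).mul_const (M₁ u)).add ((hd₂ z hz).mul_const (θ u))).neg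
    have hev : (fun z' => S u z' * H u z') =ᶠ[𝓝 z] fun z' => -(d z' * M₁ u + d₂ z' * θ u) := by
      filter_upwards [hJo.mem_nhds hz] with z' hz' using h4 u hu z' hz'
    have huniq : Sz u z * H u z + S u z * Hz u z = -(d₁ z * M₁ u + d₃ z * θ u) :=
      hLHS.unique (hRHS.congr_of_eventuallyEq hev)
    rw [hβ u hu z hz] at huniq
    linear_combination huniq
  -- (5): Cramer, `H·B = θ·r`
  have h5 : ∀ u ∈ Ioo a₁ b₁, ∀ z ∈ Ioo a₂ b₂, H u z * B u z = θ u * r z := by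
    intro u hu z hz
    have e1 := h4 u hu z hz
    have e2 := h4z u hu z hz
    simp only [hB, hr]
    linear_combination (-(d₁ z)) * e1 + d z * e2
  -- `B` as a cubic in `Θ u`
  have hBcubic : ∀ u z, B u z =
      (d z * ε z ^ 3 + 3 * d z * ε z * ε₁ z + d z * ε₂ z - d₁ z * ε z ^ 2 - d₁ z * ε₁ z) +
      (3 * d z ^ 2 * ε z ^ 2 + 3 * d z ^ 2 * ε₁ z + d z * d₁ z * ε z + d z * d₂ z - d₁ z ^ 2) * Θ u +
      (d z ^ 2 * (3 * d z * ε z + 2 * d₁ z)) * Θ u ^ 2 + d z ^ 4 * Θ u ^ 3 := by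
    intro u z
    simp only [hB, hS, hSz, hξ, hξz]
    ring
  -- the image of the `u`-interval under `Θ` is infinite
  have hinj : InjOn Θ (Ioo a₁ b₁) := injOn_of_hasDerivAt_ne_zero hΘ hθ
  have hinf : (Θ '' Ioo a₁ b₁).Infinite := (Set.Ioo_infinite hI).image hinj
  obtain ⟨z₀, hz₀⟩ : (Ioo a₂ b₂).Nonempty := nonempty_Ioo.mpr hJ
  by_cases hcase : ∃ z₁ ∈ Ioo a₂ b₂, r z₁ ≠ 0
  · -- CASE A: `r(z₁) ≠ 0`
    obtain ⟨z₁, hz₁, hr₁⟩ := hcase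
    -- scalars at the height `z₁`
    set D := d z₁ with hDdef
    set D1 := d₁ z₁
    set D2 := d₂ z₁
    set D3 := d₃ z₁
    set D4 := d₄ z₁
    set E0 := ε z₁
    set E1 := ε₁ z₁
    set E2 := ε₂ z₁
    set E3 := ε₃ z₁
    -- cubic coefficients of `B(·, z₁)` and of its `z`-derivative
    set b0 := D * E0 ^ 3 + 3 * D * E0 * E1 + D * E2 - D1 * E0 ^ 2 - D1 * E1 with hb0
    set b1 := 3 * D ^ 2 * E0 ^ 2 + 3 * D ^ 2 * E1 + D * D1 * E0 + D * D2 - D1 ^ 2 with hb1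
    set b2 := D ^ 2 * (3 * D * E0 + 2 * D1) with hb2
    set b3 := D ^ 4 with hb3
    set c0 := 3 * D * E0 ^ 2 * E1 + 3 * D * E0 * E2 + 3 * D * E1 ^ 2 + D * E3 + D1 * E0 ^ 3 + D1 * E0 * E1 - D2 * E0 ^ 2 - D2 * E1 with hc0
    set c1 := 6 * D ^ 2 * E0 * E1 + 3 * D ^ 2 * E2 + 6 * D * D1 * E0 ^ 2 + 7 * D * D1 * E1 + D * D2 * E0 + D * D3 + D1 ^ 2 * E0 - D1 * D2 with hc1
    set c2 := D * (3 * D ^ 2 * E1 + 9 * D * D1 * E0 + 2 * D * D2 + 4 * D1 ^ 2) with hc2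
    set c3 := 4 * D ^ 3 * D1 with hc3
    set R := r z₁ with hRdef
    set R1 := d₂ z₁ * d₂ z₁ - d z₁ * d₄ z₁ with hR1
    have hR : R ≠ 0 := hr₁
    have hD : D ≠ 0 := hd0 z₁ hz₁
    -- the cubic `B(u, z₁)` and its `z`-derivative at `z₁`, as functions of `u`
    set Bu : ℝ → ℝ := fun u => b0 + b1 * Θ u + b2 * Θ u ^ 2 + b3 * Θ u ^ 3 with hBu
    set Bzu : ℝ → ℝ := fun u => c0 + c1 * Θ u + c2 * Θ u ^ 2 + c3 * Θ u ^ 3 with hBzu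
    have hBu_eq : ∀ u, B u z₁ = Bu u := fun u => by rw [hBcubic]
    -- `∂_z B(u,·)` at `z₁` equals `Bzu u`
    have hBz : ∀ u ∈ Ioo a₁ b₁, HasDerivAt (fun z => B u z) (Bzu u) z₁ := by
      intro u hu
      have hξ' : HasDerivAt (fun z' => ξ u z') (ξz u z₁) z₁ := ((hd z₁ hz₁).mul_const (Θ u)).add (hε z₁ hz₁)
      have hξz' : HasDerivAt (fun z' => ξz u z') (d₂ z₁ * Θ u + ε₂ z₁) z₁ := ((hd₁ z₁ hz₁).mul_const (Θ u)).add (hε₁ z₁ hz₁)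
      have hS' : HasDerivAt (fun z' => S u z') (Sz u z₁) z₁ := by
        refine (hξz'.add (hξ'.pow 2)).congr_deriv ?_
        simp only [hSz, Nat.cast_ofNat]; ring
      have hSz' : HasDerivAt (fun z' => Sz u z')
          ((d₃ z₁ * Θ u + ε₃ z₁) + 2 * (ξz u z₁ * ξz u z₁ + ξ u z₁ * (d₂ z₁ * Θ u + ε₂ z₁))) z₁ := by
        have h1 : HasDerivAt (fun z' => d₂ z' * Θ u + ε₂ z') (d₃ z₁ * Θ u + ε₃ z₁) z₁ :=
          ((hd₂ z₁ hz₁).mul_const (Θ u)).add (hε₂ z₁ hz₁)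
        have h2 : HasDerivAt (fun z' => 2 * (ξ u z' * ξz u z')) (2 * (ξz u z₁ * ξz u z₁ + ξ u z₁ * (d₂ z₁ * Θ u + ε₂ z₁))) z₁ := by
          have := (hξ'.mul hξz').const_mul (2 : ℝ)
          refine this.congr_deriv ?_
          ring
        exact h1.add h2
      have hBd : HasDerivAt (fun z' => B u z')
          (d₁ z₁ * (Sz u z₁ + S u z₁ * ξ u z₁) +
            d z₁ * ((d₃ z₁ * Θ u + ε₃ z₁) + 2 * (ξz u z₁ * ξz u z₁ + ξ u z₁ * (d₂ z₁ * Θ u + ε₂ z₁)) +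
              (Sz u z₁ * ξ u z₁ + S u z₁ * ξz u z₁)) -
            (d₂ z₁ * S u z₁ + d₁ z₁ * Sz u z₁)) z₁ := by
        have hA := (hd z₁ hz₁).mul (hSz'.add (hS'.mul hξ'))
        have hC := (hd₁ z₁ hz₁).mul hS'
        exact hA.sub hC
      refine hBd.congr_deriv ?_
      simp only [hBzu, hc0, hc1, hc2, hc3, hS, hSz, hξ, hξz]
      ring
    -- `B(u,·) = θ u · r / H u` near `z₁`, hence another expression for the `z`-derivative
    have hrd : HasDerivAt r R1 z₁ := by
      have := ((hd₁ z₁ hz₁).mul (hd₂ z₁ hz₁)).sub ((hd z₁ hz₁).mul (hd₃ z₁ hz₁))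
      refine this.congr_deriv ?_
      simp only [hR1]; ring
    have hBz2 : ∀ u ∈ Ioo a₁ b₁, Bzu u = θ u * (R1 * H u z₁ - R * Hz u z₁) / H u z₁ ^ 2 := by
      intro u hu
      have hq : HasDerivAt (fun z => θ u * r z / H u z) (θ u * (R1 * H u z₁ - R * Hz u z₁) / H u z₁ ^ 2) z₁ := by
        have h1 : HasDerivAt (fun z => θ u * r z) (θ u * R1) z₁ := hrd.const_mul (θ u)
        have h2 := h1.div (hHz u hu z₁ hz₁) (hH0 u hu z₁ hz₁)
        refine h2.congr_deriv ?_
        simp only [hRdef]; ring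
      have hev : (fun z => B u z) =ᶠ[𝓝 z₁] fun z => θ u * r z / H u z := by
        filter_upwards [hJo.mem_nhds hz₁] with z' hz'
        have h := h5 u hu z' hz'
        field_simp [hH0 u hu z' hz']
        linarith [h]
      exact (hBz u hu).unique (hq.congr_of_eventuallyEq hev)
    -- hence `Bzu u = Bu u · (R1/R − ξ(u,z₁))`
    have hBu_val : ∀ u ∈ Ioo a₁ b₁, Bu u = θ u * R / H u z₁ := by
      intro u hu
      have h := h5 u hu z₁ hz₁
      rw [← hBu_eq]
      field_simp [hH0 u hu z₁ hz₁]
      linarith [h]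
    have hBu0 : ∀ u ∈ Ioo a₁ b₁, Bu u ≠ 0 := by
      intro u hu
      rw [hBu_val u hu]
      exact div_ne_zero (mul_ne_zero (hθ u hu) hR) (hH0 u hu z₁ hz₁)
    have hkey : ∀ u ∈ Ioo a₁ b₁, Bzu u = Bu u * (R1 / R - (D * Θ u + E0)) := by
      intro u hu
      rw [hBz2 u hu, hBu_val u hu, hβ u hu z₁ hz₁]
      field_simp [hH0 u hu z₁ hz₁, hR]
      ring
    -- differentiate `hkey` in `u`
    have hBu' : ∀ u ∈ Ioo a₁ b₁, HasDerivAt Bu ((b1 + 2 * b2 * Θ u + 3 * b3 * Θ u ^ 2) * θ u) u := by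
      intro u hu
      have h := hΘ u hu
      have := (((hasDerivAt_const u b0).add (h.const_mul b1)).add ((h.pow 2).const_mul b2)).add ((h.pow 3).const_mul b3)
      refine this.congr_deriv ?_
      simp only [Nat.cast_ofNat]
      ring
    have hBzu' : ∀ u ∈ Ioo a₁ b₁, HasDerivAt Bzu ((c1 + 2 * c2 * Θ u + 3 * c3 * Θ u ^ 2) * θ u) u := by
      intro u hu
      have h := hΘ u hu
      have := (((hasDerivAt_const u c0).add (h.const_mul c1)).add ((h.pow 2).const_mul c2)).add ((h.pow 3).const_mul c3)
      refine this.congr_deriv ?_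
      simp only [Nat.cast_ofNat]
      ring
    have hQ : ∀ u ∈ Ioo a₁ b₁,
        (c1 + 2 * c2 * Θ u + 3 * c3 * Θ u ^ 2) * Bu u - Bzu u * (b1 + 2 * b2 * Θ u + 3 * b3 * Θ u ^ 2) + D * Bu u ^ 2 = 0 := by
      intro u hu
      have hrhs : HasDerivAt (fun u' => Bu u' * (R1 / R - (D * Θ u' + E0)))
          ((b1 + 2 * b2 * Θ u + 3 * b3 * Θ u ^ 2) * θ u * (R1 / R - (D * Θ u + E0)) + Bu u * (-(D * θ u))) u := by
        have h1 : HasDerivAt (fun u' => R1 / R - (D * Θ u' + E0)) (-(D * θ u)) u := by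
          have := (((hΘ u hu).const_mul D).add_const E0).const_sub (R1 / R)
          refine this.congr_deriv ?_
          ring
        exact (hBu' u hu).mul h1
      have hev : Bzu =ᶠ[𝓝 u] fun u' => Bu u' * (R1 / R - (D * Θ u' + E0)) := by
        filter_upwards [hIo.mem_nhds hu] with u' hu' using hkey u' hu'
      have huniq : (c1 + 2 * c2 * Θ u + 3 * c3 * Θ u ^ 2) * θ u =
          (b1 + 2 * b2 * Θ u + 3 * b3 * Θ u ^ 2) * θ u * (R1 / R - (D * Θ u + E0)) + Bu u * (-(D * θ u)) :=
        (hBzu' u hu).unique (hrhs.congr_of_eventuallyEq hev)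
      have hk := hkey u hu
      have hθu := hθ u hu
      -- multiply `huniq` by `Bu u`, substitute `hkey`, divide by `θ u`
      have h3 : θ u * ((c1 + 2 * c2 * Θ u + 3 * c3 * Θ u ^ 2) * Bu u - Bzu u * (b1 + 2 * b2 * Θ u + 3 * b3 * Θ u ^ 2) +
          D * Bu u ^ 2) = 0 := by
        rw [hk]
        linear_combination (Bu u) * huniq
      exact (mul_eq_zero.mp h3).resolve_left hθu
    -- the sextic in `t = Θ u`
    have hsextic : ∀ t ∈ Θ '' Ioo a₁ b₁,
        (b0 ^ 2 * D + b0 * c1 - b1 * c0) + (2 * b0 * b1 * D + 2 * b0 * c2 - 2 * b2 * c0) * t +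
          (2 * b0 * b2 * D + 3 * b0 * c3 + b1 ^ 2 * D + b1 * c2 - b2 * c1 - 3 * b3 * c0) * t ^ 2 +
          (2 * b0 * b3 * D + 2 * b1 * b2 * D + 2 * b1 * c3 - 2 * b3 * c1) * t ^ 3 +
          (2 * b1 * b3 * D + b2 ^ 2 * D + b2 * c3 - b3 * c2) * t ^ 4 + (2 * b2 * b3 * D) * t ^ 5 + (b3 ^ 2 * D) * t ^ 6 = 0 := by
      rintro t ⟨u, hu, rfl⟩
      have h := hQ u hu
      simp only [hBu, hBzu] at h
      linear_combination h
    have h6 : b3 ^ 2 * D = 0 := sextic_coeff6_eq_zero hinf hsextic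
    have : D ^ 9 = 0 := by rw [hb3] at h6; linear_combination h6
    exact hD (pow_eq_zero_iff (by norm_num) |>.mp this)
  · -- CASE B: `r ≡ 0` on the height interval: the cubic vanishes identically
    push Not at hcase
    have hB0 : ∀ u ∈ Ioo a₁ b₁, B u z₀ = 0 := by
      intro u hu
      have h := h5 u hu z₀ hz₀
      rw [hcase z₀ hz₀, mul_zero] at h
      exact (mul_eq_zero.mp h).resolve_left (hH0 u hu z₀ hz₀)
    have hcubic : ∀ t ∈ Θ '' Ioo a₁ b₁,
        (d z₀ * ε z₀ ^ 3 + 3 * d z₀ * ε z₀ * ε₁ z₀ + d z₀ * ε₂ z₀ - d₁ z₀ * ε z₀ ^ 2 - d₁ z₀ * ε₁ z₀) +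
          (3 * d z₀ ^ 2 * ε z₀ ^ 2 + 3 * d z₀ ^ 2 * ε₁ z₀ + d z₀ * d₁ z₀ * ε z₀ + d z₀ * d₂ z₀ - d₁ z₀ ^ 2) * t +
          (d z₀ ^ 2 * (3 * d z₀ * ε z₀ + 2 * d₁ z₀)) * t ^ 2 + d z₀ ^ 4 * t ^ 3 = 0 := by
      rintro t ⟨u, hu, rfl⟩
      rw [← hBcubic u z₀]
      exact hB0 u hu
    have h3 : d z₀ ^ 4 = 0 := cubic_coeff3_eq_zero hinf hcubic
    exact hd0 z₀ hz₀ (pow_eq_zero_iff (by norm_num) |>.mp h3)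

end Summit.NavierStokesRegularity.NavierStokesRegularity.Theorems.PoloidalWindowDoorPoloidalWindowRigidityUntwistedStuartBranch

end
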